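import Summits.NavierStokesRegularity.NavierStokesRegularity.Theorems.ScenarioCensusRowF1RingTopKill
import HarnessLib

/-!
# LINE 44 «ring-top» port, part 5/6: §5 THE FLOORS, proved (`ringFloor_holds`, `helicalRingFloor_holds`), the census ROWS as corollaries (`rowF1rx_holds`, `rowF1krx_holds`), the threshold
# `ringLevel` and the floor read pointwise

Re-homed for the scenario census (typer seat ns-census-typer-1 g10; the cells F1rx / F1krx and the floors are members of row F1 «DECIDED IN KERNEL IN FILES» (LINE 44: ref ns-census-ref g16
PRE-CHECK ✓ §21.18, critic PASS, lead booking OF RECORD at census v1.133); this port makes them TREE-decided): VERBATIM PORT of ns-idea-3 LINE 44 «ring-top»,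
`pub/ideators/ns-idea-3/lines/ring-top/line-ring-top.lean` sha16 74d818dbb34ba3da (1774 l., lean check rc 0, 0 sorry), split for the 400-line rule into `ScenarioCensusRowF1RingTop`
(§1) → `…RingTopZoom` (§2–§3) → `…RingTopCovariance` (§4a) → `…RingTopKill` (§4b) → `…RingTopFloors` (§5) → `…RingTopRows` (§6–§7 + census KEYS).  Lean text VERBATIM in namespace
`…Theorems.ScenarioCensus.RingTop` (the line's `…Cruxes.ScenarioCensusRowF1.RingTopLine` re-homed); port edits: the frame restated VERBATIM by the line from LINES 34–42 (`topSet`,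
`HasTypeIConstant`, `snapLevel`, `exists_fast_at`, `sqrt_mul_sq_mul`, `continuous_slice'`, `rotLin`, `rotCLM`, `coe_rotCLM`, `analyticAt_transport`, `rotZ_smul_eZ'`, `zoom_units`,
`eventually_forall_not_of_not_frequently`, `le_of_units`) is taken BY NAME from the landed ports (the line's own STRENGTHENED compactness / socket / zoom package / `tendsto_eval` with gradients are new statements and kept; `row_of_floor` = `ScalingTop.row_of_floor` BY NAME); elementary lemmas the line restates are the tree's BY NAME (`rotZ_add_vec'` / `rotZ_add_smul_eZ'` = `ScrewBlowdown.…`,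
`rotZ_smul_vec'` = `rotZ_smul`, `rotZ_neg_rotZ'` / `rotZ_rotZ_neg'` = `RotationOrder.…`, `rotZ_zero_vec'` = `rotZ_apply_zero_vec`, `curl_const_smul'` = `curl_const_smul_field`, `continuous_rotZ`,
`centre_mem` = `IsTypeIAncientMild.comp_add_right`, `hasDerivAt_rotZ_rotGen'` = `AxisymEndLiouville.AbsorbingAxisSwirlExtinction.hasDerivAt_rotZ_rotGen`, `rotGen_add_smul_eZ'` =
`PeriodicSlab.rotGen_add_smul_eZ`, `inner_gradient_eq_fderiv` = `Wu2026Salvage.inner_gradient_right_eq`, `rotZ_single_two` = `UnthreadedRigidity.ProfileHorn.rotZ_single_two'` — cone-free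
modules imported); `tendstoLocallyUniformly_comp_of_tendsto`, `analyticAt_linIso`, `smul_coord` (twins of lemmas in route-cone modules) are not re-declared (inlined / replaced by
`PiLp.smul_apply, smul_eq_mul`); `@[conjecture]` on the residual `RingCollapse` (≡ `ScenarioCensus.Row_F1`, OPEN); one-line docstrings added where missing (gate lint).  Statements untouched.

No census VALUE is moved here (row F1 stays OPEN-WITH-LINE; the members become TREE-decided by name); NS regularity is NOT proved; `Row_F1` is untouched (zero
movement, `ringCollapse_iff_rowF1`); no summit statement is proved by this file. Lemmas that restate already-landed tree declarations are taken BY NAME (gate lint `dedup.landed`): `topSet` = `TwoTimeTop.topSet`, `HasTypeIConstant` = `OneLevelTop.HasTypeIConstant`, `snapLevel` = `SnapshotTop.snapLevel`, `exists_fast_at` = `SnapshotTop.exists_fast_at`, `sqrt_mul_sq_mul` = `SnapshotTop.sqrt_mul_sq_mul`, `centre_mem` = `IsTypeIAncientMild.comp_add_right`, `continuous_slice'` = `ScalingTop.continuous_slice'`, `rotZ_add_vec'` = `ScrewBlowdown.rotZ_add_vec`, `rotZ_smul_vec'` = `rotZ_smul`, `rotZ_add_smul_eZ'` = `ScrewBlowdown.rotZ_add_smul_eZ`,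 `rotLin` = `ScrewTop.rotLin`, `rotCLM` = `ScrewTop.rotCLM`, `analyticAt_transport` = `ScrewTop.analyticAt_transport`, `rotZ_smul_eZ'` = `ScrewTop.rotZ_smul_eZ'`, `hasDerivAt_rotZ_rotGen'` = `AxisymEndLiouville.AbsorbingAxisSwirlExtinction.hasDerivAt_rotZ_rotGen`, `rotGen_add_smul_eZ'` = `PeriodicSlab.rotGen_add_smul_eZ`, `inner_gradient_eq_fderiv` = `Wu2026Salvage.inner_gradient_right_eq`, `rotZ_single_two` = `UnthreadedRigidity.ProfileHorn.rotZ_single_two'`, `rotZ_neg_rotZ'` = `RotationOrder.rotZ_neg_rotZ`, `rotZ_rotZ_neg'` = `RotationOrder.rotZ_rotZ_neg`, `rotZ_zero_vec'` = `rotZ_apply_zero_vec`, `curl_const_smul'` = `curl_const_smul_field`, `zoom_units` = `NeedleTop.zoom_units`, `eventually_forall_not_of_not_frequently` = `EchoTop.eventually_forall_not_of_not_frequently`, `le_of_units` = `ScalingTop.le_of_units`, `row_of_floor` = `ScalingTop.row_of_floor`.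
-/

-- the summit and its single problem share the name `NavierStokesRegularity` (D-0017 nested layout)
set_option linter.dupNamespace false

noncomputable section

open MeasureTheory Set Function Filter TopologicalSpace Metric
open scoped Topology NNReal ENNReal InnerProductSpace RealInnerProductSpace

namespace Summit.NavierStokesRegularity.NavierStokesRegularity.Theorems.ScenarioCensus.RingTop

open Literature.Analysis Literature.Analysis.FluidPDE
open Summit.NavierStokesRegularity.NavierStokesRegularity.Theorems
open Summit.NavierStokesRegularity.NavierStokesRegularity.Theses
open Summit.NavierStokesRegularity.NavierStokesRegularity.Theorems.LocalHelicityTubeDoorFrobeniusProfileRigidityHelicalSlice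
open Summit.NavierStokesRegularity.NavierStokesRegularity.Theorems.NearExtremalTransiencePerFlow.FilamentSelection
open Summit.NavierStokesRegularity.NavierStokesRegularity.Theorems.LocalSineTubeDoorProfileAlignedWindowRigidityAncient

/-! ## §5 THE FLOORS (universal over fast points, every level), proved; the census ROWS as corollaries (Leray's every-time floor);
the definite ring threshold and the floor read out at it -/

-- `zoom_units`: the line restates the tree's `NeedleTop.zoom_units`; taken BY NAME (gate lint dedup.landed).

-- `eventually_forall_not_of_not_frequently`: the line restates the tree's `EchoTop.eventually_forall_not_of_not_frequently`; taken BY NAME (gate lint dedup.landed).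

-- `le_of_units`: the line restates the tree's `ScalingTop.le_of_units`; taken BY NAME (gate lint dedup.landed).

/-- **THE GENERIC FLOOR from a level** (first-order read-outs): if no `W ∈ 𝒦_M` with `‖W(−1, 0)‖ ≥ Λ` has `D`-defect below `Λ₁`, and
`D` is jointly continuous and jointly positively homogeneous in (value, curl), then in every Clay solution with Type-I constant `M`,
eventually NO `Λ`-fast point has a `D`-vortex pocket at threshold `Λ₁` (witness package of §3: the pocket read in the zoom is a `D`-defect
of the zoom with the SAME dimensionless apex `b_j` — `L⁻¹` and the curl are linear (`curl_const_smul_field`, junk-safe) and `D w` is jointly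
homogeneous, so the speed unit factors out —, and the first-order defect limit carries it to the limit member, which the level forbids). -/
theorem floor_of_level {D : E3 → E3 → E3 → ℝ} (hDc : ∀ w, Continuous fun p : E3 × E3 => D w p.1 p.2)
    (hDs : ∀ (w v ω : E3) (c : ℝ), 0 ≤ c → D w (c • v) (c • ω) = c * D w v ω)
    {M Λ : ℝ} {L : E3 ≃ₗᵢ[ℝ] E3} {A a Λ₁ : ℝ}
    (hlev : ∀ W : ℝ → E3 → E3, IsTypeIAncientMild M W → Λ ≤ ‖W (-1) 0‖ → ¬ VDefectBelow D L A a Λ₁ W)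
    {ν T : ℝ} (hν : 0 < ν) (hT : 0 < T) {u : ℝ → E3 → E3} {p : ℝ → E3 → ℝ}
    (hsol : IsClassicalNSSolutionOn (Ico 0 T) ν 0 u p) (hLH : IsLerayHopfOn T ν 0 (u 0) u)
    (hdec : HasRapidSpatialDecay (u 0)) (hM : OneLevelTop.HasTypeIConstant ν T M u) :
    ∀ᶠ t in 𝓝[<] T, ∀ x ∈ TwoTimeTop.topSet ν T u Λ t, ¬ VortexPocketAt D ν T u L A a Λ₁ t x := by
  refine EchoTop.eventually_forall_not_of_not_frequently fun hfreq => ?_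
  obtain ⟨c, x, W, hcpos, -, hW, hQ, -, -, -, hlu, hlug, hnorm⟩ :=
    exists_witnessZoom_package hν hT hsol hLH hdec hM hfreq
  apply hlev W hW hnorm
  set F : ℕ → ℝ → E3 → E3 := fun j s y => (c j * 1) • u (T + c j ^ 2 * ν * s) (x j + (c j * ν) • y) with hF
  have hpk : ∀ j, ∃ b ∈ closedBall (0 : E3) A, ∀ w ∈ closedBall (0 : E3) a,
      D w (L.symm (F j (-1) (b + L w))) (curl (fun w' => L.symm (F j (-1) (b + L w'))) w) ≤ Λ₁ := by
    intro j
    obtain ⟨hunit, hsq⟩ := NeedleTop.zoom_units (T := T) hν hcpos j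
    obtain ⟨b, hb, hpock⟩ := hQ j
    refine ⟨b, mem_closedBall_zero_iff.2 hb, fun w hw => ?_⟩
    have h1 := hpock w (mem_closedBall_zero_iff.1 hw)
    rw [hsq, hunit] at h1
    simp only [hF, LinearIsometryEquiv.map_smul]
    rw [curl_const_smul_field, hDs _ _ _ _ (mul_pos (hcpos j) one_pos).le, mul_one]
    exact ScalingTop.le_of_units hν h1
  exact vdefect_limit hDc (ScalingTop.continuous_slice' hW (by norm_num)) (continuous_fderiv_slice hW (by norm_num))
    (hlu (-1) (by norm_num)) (hlug (-1) (by norm_num)) tendsto_const_nhds hpk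

/-- **THE RING FLOOR holds** (ring level + generic floor). -/
theorem ringFloor_holds : RingFloor := by
  intro M Λ L A a hΛ ha
  obtain ⟨Λ₁, hΛ₁, hlev⟩ := exists_ringLevel M L A a ha hΛ
  exact ⟨Λ₁, hΛ₁, fun ν T hν hT u p hsol hLH hdec hM =>
    floor_of_level continuous_ringDefect (fun w v ω c hc => ringDefect_smul w v ω hc) hlev hν hT hsol hLH hdec hM⟩

/-- **THE HELICAL RING FLOOR holds** (helical ring level + generic floor). -/
theorem helicalRingFloor_holds : HelicalRingFloor := by
  intro M Λ L h A a hΛ hh ha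
  obtain ⟨Λ₁, hΛ₁, hlev⟩ := exists_helicalRingLevel M L hh A a ha hΛ
  exact ⟨Λ₁, hΛ₁, fun ν T hν hT u p hsol hLH hdec hM =>
    floor_of_level (continuous_helRingDefect h) (fun w v ω c hc => helRingDefect_smul h w v ω hc) hlev hν hT hsol hLH hdec hM⟩

-- `row_of_floor`: the line restates the tree's `ScalingTop.row_of_floor`; taken BY NAME (gate lint dedup.landed).

/-- **ROW F1rx holds** (ring floor at `c_S` + Leray's every-time floor). -/
theorem rowF1rx_holds : Row_F1rx := by
  intro M L A a ha
  obtain ⟨ε, hε, hfl⟩ := ringFloor_holds M SnapshotTop.snapLevel L A a SnapshotTop.snapLevel_pos ha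
  exact ⟨ε, hε, fun ν T hν hT u p hsol hLH hdec hM hfreq =>
    ScalingTop.row_of_floor hν hT hsol hLH hdec (hfl ν T hν hT u p hsol hLH hdec hM) hfreq⟩

/-- **ROW F1krx holds** (helical ring floor at `c_S` + Leray's every-time floor). -/
theorem rowF1krx_holds : Row_F1krx := by
  intro M L h A a hh ha
  obtain ⟨ε, hε, hfl⟩ := helicalRingFloor_holds M SnapshotTop.snapLevel L h A a SnapshotTop.snapLevel_pos hh ha
  exact ⟨ε, hε, fun ν T hν hT u p hsol hLH hdec hM hfreq =>
    ScalingTop.row_of_floor hν hT hsol hLH hdec (hfl ν T hν hT u p hsol hLH hdec hM) hfreq⟩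

open scoped Classical in
/-- **The definite ring threshold `ringLevel M Λ L A a`** — a witness of the floor (ineffective: compactness); `1` off the admissible
parameter range. -/
def ringLevel (M Λ : ℝ) (L : E3 ≃ₗᵢ[ℝ] E3) (A a : ℝ) : ℝ :=
  if hp : 0 < Λ ∧ 0 < a then Classical.choose (ringFloor_holds M Λ L A a hp.1 hp.2) else 1

/-- The ring threshold is positive. -/
theorem ringLevel_pos (M Λ : ℝ) (L : E3 ≃ₗᵢ[ℝ] E3) (A a : ℝ) : 0 < ringLevel M Λ L A a := by
  unfold ringLevel
  split_ifs with hp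
  · exact (Classical.choose_spec (ringFloor_holds M Λ L A a hp.1 hp.2)).1
  · exact one_pos

/-- **THE RING FLOOR, read out at its definite threshold**: in a Clay solution with Type-I constant `M`, for all late instants `t`, EVERY
`Λ`-fast point `x` and EVERY candidate apex `x + ℓb`, `‖b‖ ≤ A`, admit a point `w`, `‖w‖ ≤ a`, of the pocket at which the vortex lines
LEAVE the coaxial circle or the flow SWIRLS: `√(T − t) · (|Ω₂| + |w₀Ω₀ + w₁Ω₁| + |w₀G₁ − w₁G₀|)(w) > ringLevel · √ν`. -/
theorem ringFloor_read {M Λ : ℝ} {L : E3 ≃ₗᵢ[ℝ] E3} {A a : ℝ} (hΛ : 0 < Λ) (ha : 0 < a)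
    {ν T : ℝ} (hν : 0 < ν) (hT : 0 < T) {u : ℝ → E3 → E3} {p : ℝ → E3 → ℝ}
    (hsol : IsClassicalNSSolutionOn (Ico 0 T) ν 0 u p) (hLH : IsLerayHopfOn T ν 0 (u 0) u)
    (hdec : HasRapidSpatialDecay (u 0)) (hM : OneLevelTop.HasTypeIConstant ν T M u) :
    ∀ᶠ t in 𝓝[<] T, ∀ x ∈ TwoTimeTop.topSet ν T u Λ t, ∀ b : E3, ‖b‖ ≤ A →
      ∃ w : E3, ‖w‖ ≤ a ∧
        ringLevel M Λ L A a * Real.sqrt ν <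
          Real.sqrt (T - t) * ringDefect w (L.symm (u t (x + (Real.sqrt (ν * (T - t))) • (b + L w))))
            (curl (fun w' : E3 => L.symm (u t (x + (Real.sqrt (ν * (T - t))) • (b + L w')))) w) := by
  have hp : 0 < Λ ∧ 0 < a := ⟨hΛ, ha⟩
  have hspec := (Classical.choose_spec (ringFloor_holds M Λ L A a hp.1 hp.2)).2 ν T hν hT u p hsol hLH hdec hM
  have hlev : ringLevel M Λ L A a = Classical.choose (ringFloor_holds M Λ L A a hp.1 hp.2) := by
    unfold ringLevel
    rw [dif_pos hp]
  filter_upwards [hspec] with t ht x hx b hb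
  by_contra hno
  push Not at hno
  exact ht x hx ⟨b, hb, fun w hw => by have h' := hno w hw; rwa [hlev] at h'⟩

end Summit.NavierStokesRegularity.NavierStokesRegularity.Theorems.ScenarioCensus.RingTop

end
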